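import Summits.Ventures.HSemireg.TenfoldDoor
import Summits.Ventures.HSemireg.AmplificationChainG4Etale
import HarnessLib

/-!
# Venture HSemireg — bridge (B1) at the S4 RUNG `n = 6` (abelian TWELVEFOLDS, `K = ℚ(√-d)`): a VHC-instance on the SPLIT
# `(6, K)` Weil component ⟹ the Weil classes of EVERY split `K`-Weil twelvefold AND of EVERY `K`-Weil `2n`-fold, `2 ≤ n ≤ 5`

HONEST FRAMING. Lean index of the computation cell `pub-hsemireg`, track «S4-PUSH» (iii), seat s4-bridge-1 (bridge (B1)).
NOTHING about any explicit variety is asserted; NO object is claimed to exist; every published input is a hypothesis BY NAME;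
nothing here says that HC, HC_CM or HC_AV is proved. THEOREMS ONLY (one-line compositions of tree theorems): no `def`, no
named fact, no `sorry`, no new axiom. Companion of `TenfoldDoor.lean` (level `N = 5`) one level up — the level of the
conjecture (S4) of `general-structure/STRUCTURE.md` §2: «semiregular class-exact boxes on the split component `(n, K, (−1)ⁿ·Nm)`
EXIST […] at every `n ≡ 2 (mod 4)`, `n ≥ 6`», whose first open rung is `n = 6`, and of the sentence recorded there: «a
semiregular class-exact secant box on the SPLIT `(6, K)` component of Weil 12-folds would, by the ladder, give the Weil classes
on all Weil-type abelian varieties of dim `≤ 10` with field `K`».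

## (B1) «VHC-instance ⇒ whole-component algebraicity» in the Weil currency, and its decomposition BY NAME

* VHC-INSTANCE at the anchor = the Literature predicate `HasLocallyAlgebraicWeilAnchor 6 d` (`WeilClassesLocalAnchor.lean`): ONE
  hyperbolic (= split) `K`-Weil twelvefold `(P, ψ₀, h_K)` with a non-zero rational Weil class `w` such that along EVERY smooth
  projective family of `K`-abelian twelvefolds through `P` carrying global classes `H ↦ h_K`, `W ↦ w` (fibrewise rational
  `(1,1)` / `(6,6)`), `q·H_s⁶ + W_s` is algebraic for `s` in an OPEN neighbourhood of the anchor — EXACTLY the output shape of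
  a semiregularity theorem (OPENNESS): Bloch 1972 (7.4)/(7.5) for an lci cycle (`BlochSemiregularSpread 12 6` +
  `HasHyperbolicBlochSeed 6 d`), Buchweitz–Flenner 2003 Thm. 5.1 for a vector bundle
  (`BuchweitzFlenner2003_variationalHodge_ISemiregular{,_model}` + a sheaf seed), Pridham 2024 / Perry 2022 + Lieblich charts
  for a perfect complex (`PerfectComplexDeformsOverEtaleNbhd C Adm` + a seed of class `perfectObjClass C Adm`), or — door-
  agnostically — `LocalVariationalHodgeFor 𝒪 ∧ HasHyperbolicSeedOn 𝒪 6 d` for any object class `𝒪`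
  (`AmplificationChainAssembly.lean`). The S4 object (a class-alive semiregular secant box on `X × X′`, `dim X = 6`) is such a seed
  for the `𝒪` of its door; a `G`-equivariant / twisted design needs a twisted door (Markman 2025 Conj. 7.3.9, arXiv:2502.03415 v2
  p. 44 — a THEOREM for families of abelian varieties, §7.4 pp. 45–49; Perry; NOT BF 5.1).
* CLOSEDNESS («the locus where the class is algebraic is a countable union of closed algebraic subsets», Bloch p. 65 L19–21,
  Charles–Schnell 11.3.11, Voisin II §3.3.1 / §7.3.2, Voisin 2016 §4.2 Thm. 6 and the relative-Hilbert-scheme paragraph) is a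
  TREE THEOREM (`charlesSchnell_algebraicityLocus_iUnion_closed_holds`) used INSIDE the engine
  `WeilTypeLadder.weilClasses_algebraic_hyperbolic_of_localAnchor` together with Baire on `S(ℂ)`, Lefschetz (1,1) for `q·H⁶`, «one
  Weil class suffices» and isogeny descent — none of it is a hypothesis here.
* THE COMPONENT («whole-component») = Deligne's polarized Weil family through the anchor: it is IRREDUCIBLE, carries the
  polarization class and the flat Weil sections, and REACHES every hyperbolic `(A, φ)` of the same `(K, 2n)` up to `K`-isogeny —
  the refereed named fact `weilFamilyReach_hyperbolic` (Deligne 1982 proof of Thm. 4.8; van Geemen 5.2–5.4; Landherr; Milne),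
  BY NAME. (In the 𝒜_g currency this is the chart hypothesis `SiegelHodgeLocusChartAt`; here no chart is assumed.)
* BELOW THE RUNG: the tree's PROVED degeneration edge `stub_descend` (partner Weil-type varieties of complementary
  discriminant, van Geemen 5.4 (5.4.1), 5.5–5.7; Schoen's product transfer, Compositio 114 (1998), paragraph 10 (Proposition),
  p. 332), iterated: split level `6` ⟹ `WeilAlgebraicAll n d` for every `2 ≤ n ≤ 5` — split AND non-split components of dimensions `4, 6, 8, 10`.

## Contents (namespace `Summit.Ventures.HSemireg`; every theorem is an instance at `N = 6` of a tree theorem ∀ `N`)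

* `weilTwelvefoldsSplit_of_reach_of_localAnchor_six` — reach ∧ `HasLocallyAlgebraicWeilAnchor 6 d` ⟹
  `Stubs.WeilAlgebraicSplitHyperplane 6 d`; `weilClassesOf_twelvefold_le_algebraicClasses_of_reach_of_localAnchor_six` (unfolded).
* `weilAlgebraicAll_of_reach_of_localAnchor_six` (`2 ≤ n < 6`) and `weilAlgebraicAll_le_five_of_reach_of_localAnchor_six`
  (the conjunction `n = 5, 4, 3, 2`).
* door-agnostic: `weilTwelvefoldsSplit_of_reach_of_localVariationalHodgeFor_of_hyperbolicSeedOn_six`,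
  `weilAlgebraicAll_le_five_of_reach_of_localVariationalHodgeFor_of_hyperbolicSeedOn_six`.
* doors: `…_of_blochSpread_of_hyperbolicBlochSeed_six` (Bloch, integral lci), `…_of_blochSpreadOfSubscheme_of_subschemeSeedAt_six`
  (ANY lci subscheme — the non-secant-types corner), `…_of_blochSpreadSmoothComponents_of_unionSeedAt_six` (reduced lci unions), `…_of_BFmodel_of_hyperbolicBFSheafSeedOn_six` (BF 5.1, one
  model), `…_of_BF_of_hyperbolicBFSheafSeed_six` (BF 5.1, any model), `…_of_deformsOverEtaleNbhd_of_hyperbolicSeedOn_six` (perfect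
  complexes, printed étale shape; schema in `Adm`), `…_of_perryTwisted_kappaAnchorObject_six` (twisted `B`-field door, CLAIM-GRADE:
  Perry 2026 unrefereed; the door a `G`-equivariant design descends to, locally free form).
* BY VALUE (§4, what a certified census row at the rung instantiates): `hasHyperbolicSeedOn_perfectObjClass_of_complex` (any `N`:
  anchor + `w` + ONE `Adm`-admissible bounded VB complex `E` + the class identity ⟹ `HasHyperbolicSeedOn (perfectObjClass C Adm) N d`)
  and `weilTwelvefoldsSplit_and_below_of_deformsOverEtaleNbhd_sigma_of_complex_six` (σ-door, `Ext^{<0} = 0`, `Hom = ℂ`,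
  `IsISemiregularC` BY VALUE, `ch₆ = q·h_K⁶ + w` — the n = 6 twin of `weilFourfoldsSplit_of_reach_of_sigmaDeformsOverEtaleNbhd_of_complex`)
  and `weilTwelvefoldsSplit_and_below_of_BFmodel_of_sheaf_six` (BF door BY VALUE: ONE finite locally free `ℰ₀` on `P.X`, `IsISemiregular`,
  `ch₆(ℰ₀) = q·h_K⁶ + w`).

References: [Bloch1972Semiregularity] Thm. (7.4), proof p. 65, Remark (7.5); [BuchweitzFlenner2003] §5 Thm. 5.1;
[CharlesSchnell2014Notes] Prop. 11.3.11 (proof); [Voisin2016HodgeConjectureSurvey] §4.2 Thm. 6; [Deligne1982HodgeCycles] proof of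
Thm. 4.8; [vanGeemen1994HodgeAV] 5.2–5.7, 6.12; [Schoen1998HodgeWeilAddendum] 10 (Proposition), p. 332 (the Addendum numbers
paragraphs, not sections); [Perry2022] proof of Prop. 8.1; [Pridham2024Semiregularity] Cor. 2.25, Rem. 2.27; [Markman2025SurveySecant] §11.5 Step 2 (the printed pattern one dimension down; preprint).
-/

noncomputable section

open CategoryTheory AlgebraicGeometry

namespace Summit.Ventures.HSemireg
open Literature.AlgebraicGeometry Literature.AlgebraicGeometry.Motives
open Literature.AlgebraicGeometry.HodgeTheory
open Literature.AlgebraicTopology.SingularHomology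
open Summit.HodgeConjecture.HodgeConjecture
open Summit.HodgeConjecture.HodgeConjecture.WeilTypeLadder
open Summit.HodgeConjecture.HodgeConjecture.Cruxes.HodgeAbelianVarieties.EStepSecantInduction
open Summit.Ventures.HSemireg.GeneralStructure

/-! ## §1 The anchor currency: a VHC-instance on the split `(6, K)` component -/

section Anchor

/-- **(B1) at the S4 rung, anchor currency: Deligne's reach ∧ ONE locally algebraic hyperbolic `ℚ(√-d)`-anchor in dimension
`12` ⟹ the Weil classes of EVERY split `√-d`-Weil abelian TWELVEFOLD are algebraic** (`Stubs.WeilAlgebraicSplitHyperplane 6 d`).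
VHC-instance = `hL` (openness at the anchor, the output of a semiregularity theorem); closedness + Baire + Lefschetz (1,1) + «one
Weil class suffices» + isogeny = the tree engine `weilClasses_algebraic_hyperbolic_of_localAnchor` (no hypothesis); the
component and its reach = `hF` (refereed named fact). Instance `N = 6` of `AmplificationChainAssembly` §3 / `Leverage.lean`.
[cite: Deligne1982HodgeCycles, proof of Thm. 4.8] [cite: vanGeemen1994HodgeAV, 5.2–5.4 and proof of Thm. 6.12]
[cite: CharlesSchnell2014Notes, Prop. 11.3.11 (proof)] [cite: Bloch1972Semiregularity, proof of Thm. (7.4), p. 65] -/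
theorem weilTwelvefoldsSplit_of_reach_of_localAnchor_six (hF : weilFamilyReach_hyperbolic) {d : ℕ} (hd : 0 < d)
    (hL : HasLocallyAlgebraicWeilAnchor 6 d) : Stubs.WeilAlgebraicSplitHyperplane 6 d := by
  intro A φ e a hA hφ ha ha0 hhyp c hcW _ _
  exact weilClasses_algebraic_hyperbolic_of_localAnchor 6 d (by norm_num) hd hL hF A φ hA hφ e a ha ha0 hhyp hcW

/-- **The same, unfolded**: under reach ∧ `HasLocallyAlgebraicWeilAnchor 6 d`, for every complex abelian TWELVEFOLD `A` with
`φ ≫ φ = -(d • 𝟙 A)`, every projective embedding `e_A` and rational `a_A ≠ 0` such that `(A, φ)` is of hyperbolic (= split) Weil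
type for `h_K = d·e_A^*a_A + φ^*e_A^*a_A`, the whole Weil plane `weilClassesOf A φ 6 d ⊆ H¹²(A(ℂ); ℂ)` consists of algebraic classes.
[cite: Deligne1982HodgeCycles, proof of Thm. 4.8] [cite: vanGeemen1994HodgeAV, 5.2–5.4] -/
theorem weilClassesOf_twelvefold_le_algebraicClasses_of_reach_of_localAnchor_six (hF : weilFamilyReach_hyperbolic) {d : ℕ}
    (hd : 0 < d) (hL : HasLocallyAlgebraicWeilAnchor 6 d) (A : AbelianVariety ℂ) (φ : A ⟶ A) (hA : A.dim = 2 * 6)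
    (hφ : φ ≫ φ = -(d • 𝟙 A)) (eA : ProjectiveEmbedding A.X) (aA : complexBetti (projectiveSpace eA.n ℂ) 2)
    (haA : IsRationalClass aA) (haA0 : aA ≠ 0)
    (hhypA : IsHyperbolicWeilType A φ 6
      ((d : ℂ) • complexBetti.map eA.ι 2 aA + complexBetti.map φ.hom.hom.hom 2 (complexBetti.map eA.ι 2 aA))) :
    weilClassesOf A φ 6 d ≤ algebraicClasses A.X 6 :=
  weilClasses_algebraic_hyperbolic_of_localAnchor 6 d (by norm_num) hd hL hF A φ hA hφ eA aA haA haA0 hhypA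

/-- **Below the rung**: reach ∧ `HasLocallyAlgebraicWeilAnchor 6 d` ⟹ `WeilAlgebraicAll n d` for every `2 ≤ n < 6` — every
rational `(n,n)` Weil class on every `√-d`-Weil abelian `2n`-fold, split AND non-split components (Schoen's descent = the tree's
`stub_descend`, iterated; instance `N = 6` of `weilAlgebraicAll_of_localAnchor_lt`). [cite: Schoen1998HodgeWeilAddendum, 10 (Proposition), p. 332]
[cite: vanGeemen1994HodgeAV, 4.14, 5.4 (5.4.1) and 5.5–5.7] [cite: Deligne1982HodgeCycles, proof of Thm. 4.8] -/
theorem weilAlgebraicAll_of_reach_of_localAnchor_six (hF : weilFamilyReach_hyperbolic) {d : ℕ} (hd : 0 < d)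
    (hL : HasLocallyAlgebraicWeilAnchor 6 d) {n : ℕ} (hn : 2 ≤ n) (hn6 : n < 6) : WeilAlgebraicAll n d :=
  weilAlgebraicAll_of_localAnchor_lt hF hL hn hn6 hd

/-- **The S4 rung's payoff as ONE conjunction** («all Weil-type abelian varieties of dim `≤ 10` with field `K`»): reach ∧
`HasLocallyAlgebraicWeilAnchor 6 d` ⟹ `WeilAlgebraicAll 5 d ∧ WeilAlgebraicAll 4 d ∧ WeilAlgebraicAll 3 d ∧ WeilAlgebraicAll 2 d`
(tenfolds, eightfolds, sixfolds, fourfolds of `K = ℚ(√-d)`, every discriminant). [cite: Schoen1998HodgeWeilAddendum, 10 (Proposition), p. 332]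
[cite: Deligne1982HodgeCycles, proof of Thm. 4.8] -/
theorem weilAlgebraicAll_le_five_of_reach_of_localAnchor_six (hF : weilFamilyReach_hyperbolic) {d : ℕ} (hd : 0 < d)
    (hL : HasLocallyAlgebraicWeilAnchor 6 d) :
    WeilAlgebraicAll 5 d ∧ WeilAlgebraicAll 4 d ∧ WeilAlgebraicAll 3 d ∧ WeilAlgebraicAll 2 d :=
  ⟨weilAlgebraicAll_of_reach_of_localAnchor_six hF hd hL (by norm_num) (by norm_num),
    weilAlgebraicAll_of_reach_of_localAnchor_six hF hd hL (by norm_num) (by norm_num),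
    weilAlgebraicAll_of_reach_of_localAnchor_six hF hd hL (by norm_num) (by norm_num),
    weilAlgebraicAll_of_reach_of_localAnchor_six hF hd hL le_rfl (by norm_num)⟩

end Anchor

/-! ## §2 Door-agnostic: the local variational statement for an object class `𝒪` and ONE hyperbolic seed of class `𝒪` at level `6` -/

section DoorAgnostic

variable {𝒪 : ObjClass}

/-- **(B1) at the S4 rung, door-agnostic**: reach ∧ `LocalVariationalHodgeFor 𝒪` (the OPENNESS statement for the object class
`𝒪`: BF 5.1 for vector bundles, Pridham + Lieblich charts for perfect complexes, a twisted theorem for twisted objects — BY NAME) ∧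
ONE hyperbolic seed of class `𝒪` on a split `ℚ(√-d)`-Weil twelvefold (`HasHyperbolicSeedOn 𝒪 6 d`: the S4 object with its class
identity `κ₆ = q·h_K⁶ + w`, `κ_p = c_p·h_Kᵖ` off `6`) ⟹ every split `√-d`-Weil twelvefold. Instance `N = 6` of
`splitHyperplane_of_reach_of_localVariationalHodgeFor_of_hyperbolicSeedOn`. [cite: BuchweitzFlenner2003, §5 Thm. 5.1 (binder shape)]
[cite: Deligne1982HodgeCycles, proof of Thm. 4.8] [cite: CharlesSchnell2014Notes, Prop. 11.3.11 (proof)] -/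
theorem weilTwelvefoldsSplit_of_reach_of_localVariationalHodgeFor_of_hyperbolicSeedOn_six (hF : weilFamilyReach_hyperbolic)
    (hT : LocalVariationalHodgeFor 𝒪) {d : ℕ} (hd : 0 < d) (hS : HasHyperbolicSeedOn 𝒪 6 d) :
    Stubs.WeilAlgebraicSplitHyperplane 6 d :=
  splitHyperplane_of_reach_of_localVariationalHodgeFor_of_hyperbolicSeedOn hF (by norm_num) hd hT hS

/-- **Door-agnostic, below the rung**: reach ∧ `LocalVariationalHodgeFor 𝒪` ∧ `HasHyperbolicSeedOn 𝒪 6 d` ⟹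
`WeilAlgebraicAll 5 d ∧ WeilAlgebraicAll 4 d ∧ WeilAlgebraicAll 3 d ∧ WeilAlgebraicAll 2 d`.
[cite: Schoen1998HodgeWeilAddendum, 10 (Proposition), p. 332] [cite: Deligne1982HodgeCycles, proof of Thm. 4.8] -/
theorem weilAlgebraicAll_le_five_of_reach_of_localVariationalHodgeFor_of_hyperbolicSeedOn_six
    (hF : weilFamilyReach_hyperbolic) (hT : LocalVariationalHodgeFor 𝒪) {d : ℕ} (hd : 0 < d)
    (hS : HasHyperbolicSeedOn 𝒪 6 d) :
    WeilAlgebraicAll 5 d ∧ WeilAlgebraicAll 4 d ∧ WeilAlgebraicAll 3 d ∧ WeilAlgebraicAll 2 d :=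
  weilAlgebraicAll_le_five_of_reach_of_localAnchor_six hF hd
    (hasLocallyAlgebraicWeilAnchor_of_localVariationalHodgeFor_of_hyperbolicSeedOn hT hS)

end DoorAgnostic

/-! ## §3 The typed doors at level `6` (integral lci · any lci · lci unions · BF one-model · BF any-model · perfect complexes · twisted, claim-grade) -/

section Doors

/-- **Bloch door (lci cycle) at the S4 rung**: `BlochSemiregularSpread 12 6` (Bloch 1972 (7.4)/(7.5) = BF Thm. 5.2 at `I = {6}`,
refereed named fact) ∧ reach ∧ ONE hyperbolic Bloch seed `HasHyperbolicBlochSeed 6 d` (an integral Bloch-semiregular lci SIXFOLD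
`Z ↪ P` of codimension `6` on a split `ℚ(√-d)`-Weil twelvefold with `q·h_K⁶ + w` supported on `Z`) ⟹ every split `√-d`-Weil
twelvefold and `WeilAlgebraicAll n d`, `2 ≤ n ≤ 5`. [cite: Bloch1972Semiregularity, Thm. (7.4) and Remark (7.5), p. 65]
[cite: Deligne1982HodgeCycles, proof of Thm. 4.8] [cite: Schoen1998HodgeWeilAddendum, 10 (Proposition), p. 332] -/
theorem weilTwelvefoldsSplit_and_below_of_blochSpread_of_hyperbolicBlochSeed_six (hB : BlochSemiregularSpread (2 * 6) 6)
    (hF : weilFamilyReach_hyperbolic) {d : ℕ} (hd : 0 < d) (hS : HasHyperbolicBlochSeed 6 d) :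
    Stubs.WeilAlgebraicSplitHyperplane 6 d ∧
      (WeilAlgebraicAll 5 d ∧ WeilAlgebraicAll 4 d ∧ WeilAlgebraicAll 3 d ∧ WeilAlgebraicAll 2 d) :=
  have hL : HasLocallyAlgebraicWeilAnchor 6 d := hasLocallyAlgebraicWeilAnchor_of_blochSpread_of_hyperbolicBlochSeed hB hS
  ⟨weilTwelvefoldsSplit_of_reach_of_localAnchor_six hF hd hL, weilAlgebraicAll_le_five_of_reach_of_localAnchor_six hF hd hL⟩

/-- **Buchweitz–Flenner door (vector bundle, ONE model) at the S4 rung**: BF Thm. 5.1 in its model rendering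
(`BuchweitzFlenner2003_variationalHodge_ISemiregular_model`, refereed named fact; `ℰ₀` FINITE LOCALLY FREE and untwisted) ∧ reach ∧
ONE hyperbolic one-model `I`-semiregular vector-bundle seed on a split `ℚ(√-d)`-Weil twelvefold (`HasHyperbolicBFSheafSeedOn C 6 d I`:
`ch₆(ℰ₀) = q·h_K⁶ + w`, `ch_p(ℰ₀) = c_p·h_Kᵖ` off `6`, `(σ_{p-1})_{p ∈ I}` jointly injective on the tree's real `σ`-carrier) ⟹ every
split `√-d`-Weil twelvefold and `WeilAlgebraicAll n d`, `2 ≤ n ≤ 5`. Scope: a `G`-equivariant / twisted S4 design is NOT an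
instance (its door is a twisted theorem). [cite: BuchweitzFlenner2003, §5 Thm. 5.1 and Def. 4.1]
[cite: Deligne1982HodgeCycles, proof of Thm. 4.8] [cite: Schoen1998HodgeWeilAddendum, 10 (Proposition), p. 332] -/
theorem weilTwelvefoldsSplit_and_below_of_BFmodel_of_hyperbolicBFSheafSeedOn_six
    (hBF : BuchweitzFlenner2003_variationalHodge_ISemiregular_model) (hF : weilFamilyReach_hyperbolic)
    {C : ChernCharacterBetti} {I : Finset ℕ} {d : ℕ} (hd : 0 < d) (hS : HasHyperbolicBFSheafSeedOn C 6 d I) :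
    Stubs.WeilAlgebraicSplitHyperplane 6 d ∧
      (WeilAlgebraicAll 5 d ∧ WeilAlgebraicAll 4 d ∧ WeilAlgebraicAll 3 d ∧ WeilAlgebraicAll 2 d) :=
  have hT : LocalVariationalHodgeFor (bfSheafClass C) := localVariationalHodgeFor_bfSheafClass hBF C
  have hS' : HasHyperbolicSeedOn (bfSheafClass C) 6 d := hasHyperbolicSeedOn_bfSheafClass_of_hasHyperbolicBFSheafSeedOn hS
  ⟨weilTwelvefoldsSplit_of_reach_of_localVariationalHodgeFor_of_hyperbolicSeedOn_six hF hT hd hS',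
    weilAlgebraicAll_le_five_of_reach_of_localVariationalHodgeFor_of_hyperbolicSeedOn_six hF hT hd hS'⟩

/-- **Buchweitz–Flenner door, seed on ANY model of the anchor (TenfoldDoor's D2 one level up)**: BF Thm. 5.1
(`BuchweitzFlenner2003_variationalHodge_ISemiregular`, refereed named fact, finite locally free `ℰ₀`) ∧ reach ∧ `HasHyperbolicBFSheafSeed C 6 d I`
(th-2's seed: the `I`-semiregular vector bundle may sit on any `X₀ ≅ P.X`) ⟹ every split `√-d`-Weil twelvefold and `WeilAlgebraicAll n d`,
`2 ≤ n ≤ 5` (instances `N = 6` of `GeneralStructure.splitHyperplane_of_reach_of_BF_of_sheafSeed` and `weilAlgebraicAll_of_sheafSeed_lt`).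
[cite: BuchweitzFlenner2003, §5 Thm. 5.1] [cite: Deligne1982HodgeCycles, proof of Thm. 4.8] [cite: Schoen1998HodgeWeilAddendum, 10 (Proposition), p. 332] -/
theorem weilTwelvefoldsSplit_and_below_of_BF_of_hyperbolicBFSheafSeed_six
    (hBF : BuchweitzFlenner2003_variationalHodge_ISemiregular) (hF : weilFamilyReach_hyperbolic)
    {C : ChernCharacterBetti} {I : Finset ℕ} {d : ℕ} (hd : 0 < d) (hS : HasHyperbolicBFSheafSeed C 6 d I) :
    Stubs.WeilAlgebraicSplitHyperplane 6 d ∧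
      (WeilAlgebraicAll 5 d ∧ WeilAlgebraicAll 4 d ∧ WeilAlgebraicAll 3 d ∧ WeilAlgebraicAll 2 d) :=
  ⟨splitHyperplane_of_reach_of_BF_of_sheafSeed hF (by norm_num) hd hBF hS,
    weilAlgebraicAll_of_sheafSeed_lt hF hBF hS (by norm_num) (by norm_num) hd,
    weilAlgebraicAll_of_sheafSeed_lt hF hBF hS (by norm_num) (by norm_num) hd,
    weilAlgebraicAll_of_sheafSeed_lt hF hBF hS (by norm_num) (by norm_num) hd,
    weilAlgebraicAll_of_sheafSeed_lt hF hBF hS le_rfl (by norm_num) hd⟩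

/-- **Perfect-complex door at the S4 rung, printed ÉTALE shape** (schema in the admissibility notion `Adm`; for
`Adm = sigmaAdmissible` the assumption `PerfectComplexDeformsOverEtaleNbhd C Adm` is IMPLIED in the tree by `PridhamPerfectLifts C`
([Pridham2024] Cor. 2.25 / Rem. 2.27, printed + refereed) ∧ Lieblich-type versal charts, EGA IV 17 being kernel —
`AmplificationChainG4SigmaLadder.lean` rungs R0–R5): «admissible perfect complexes on the fibre of a smooth projective family,
Hodge along `U`, deform over an étale neighbourhood with the same `ch|_I`» ∧ reach ∧ ONE hyperbolic seed of class
`perfectObjClass C Adm` on a split `ℚ(√-d)`-Weil twelvefold ⟹ every split `√-d`-Weil twelvefold and `WeilAlgebraicAll n d`,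
`2 ≤ n ≤ 5`. [cite: Perry2022, proof of Prop. 8.1] [cite: Pridham2024Semiregularity, Cor. 2.25, Rem. 2.27]
[cite: Deligne1982HodgeCycles, proof of Thm. 4.8] [cite: Schoen1998HodgeWeilAddendum, 10 (Proposition), p. 332] -/
theorem weilTwelvefoldsSplit_and_below_of_deformsOverEtaleNbhd_of_hyperbolicSeedOn_six {C : ChernCharacterBetti}
    {Adm : AdmissibilityNotion} (hD : PerfectComplexDeformsOverEtaleNbhd C Adm) (hF : weilFamilyReach_hyperbolic) {d : ℕ}
    (hd : 0 < d) (hS : HasHyperbolicSeedOn (perfectObjClass C Adm) 6 d) :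
    Stubs.WeilAlgebraicSplitHyperplane 6 d ∧
      (WeilAlgebraicAll 5 d ∧ WeilAlgebraicAll 4 d ∧ WeilAlgebraicAll 3 d ∧ WeilAlgebraicAll 2 d) :=
  ⟨weilTwelvefoldsSplit_of_reach_of_localVariationalHodgeFor_of_hyperbolicSeedOn_six hF hD.localVariationalHodgeFor hd hS,
    weilAlgebraicAll_le_five_of_reach_of_localVariationalHodgeFor_of_hyperbolicSeedOn_six hF hD.localVariationalHodgeFor hd hS⟩

/-- **Bloch door for an ARBITRARY lci subscheme (reducible / non-reduced allowed) at the S4 rung** — the door for the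
«non-secant types» corner (sub-torus arrangements, complete-intersection / zero-locus / degeneracy cycles as lci SUBSCHEMES):
`BlochSemiregularSpreadOfSubscheme 12 6` (Bloch (7.1)/(7.4) for any lci, class = `subschemeClass`; refereed named fact) ∧ reach ∧ a
hyperbolic anchor `(P, ψ₀, ι, a)` of dimension `12` with a non-zero rational Weil class `w` and ONE subscheme seed
`HasBlochSubschemeSeedAt 6 P h_K w` (a Bloch-semiregular lci `Z ↪ P.X` of codimension `6` with `q·h_K⁶ + w = μ·[Z]`, `μ ≠ 0`) ⟹ every
split `√-d`-Weil twelvefold and `WeilAlgebraicAll 5 d ∧ 4 ∧ 3 ∧ 2` (p3's `weilAnchorLocalClause_of_blochSpreadOfSubscheme_of_subschemeSeedAt`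
at `n = 6`). [cite: Bloch1972Semiregularity, Thm. (7.1), Thm. (7.4) and Remark (7.5)] [cite: Deligne1982HodgeCycles, proof of Thm. 4.8]
[cite: Schoen1998HodgeWeilAddendum, 10 (Proposition), p. 332] -/
theorem weilTwelvefoldsSplit_and_below_of_blochSpreadOfSubscheme_of_subschemeSeedAt_six
    (hB : BlochSemiregularSpreadOfSubscheme (2 * 6) 6) (hF : weilFamilyReach_hyperbolic) {d : ℕ} (hd : 0 < d)
    (P : AbelianVariety ℂ) (ψ₀ : P ⟶ P) (ι : ProjectiveEmbedding P.X) (a : complexBetti (projectiveSpace ι.n ℂ) 2)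
    (w : complexBetti P.X (2 * 6)) (hP : P.dim = 2 * 6) (hψ : ψ₀ ≫ ψ₀ = -(d • 𝟙 P)) (ha : IsRationalClass a)
    (ha0 : a ≠ 0) (hhyp : IsHyperbolicWeilType P ψ₀ 6 (symmetrisedClass d P ψ₀ ι a))
    (hwW : w ∈ weilClassesOf P ψ₀ 6 d) (hwr : IsRationalClass w) (hw0 : w ≠ 0)
    (hS : HasBlochSubschemeSeedAt 6 P (symmetrisedClass d P ψ₀ ι a) w) :
    Stubs.WeilAlgebraicSplitHyperplane 6 d ∧
      (WeilAlgebraicAll 5 d ∧ WeilAlgebraicAll 4 d ∧ WeilAlgebraicAll 3 d ∧ WeilAlgebraicAll 2 d) :=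
  have hL : HasLocallyAlgebraicWeilAnchor 6 d :=
    (hasLocallyAlgebraicWeilAnchor_iff 6 d).2
      ⟨P, ψ₀, ι, a, w, hP, hψ, ha, ha0, hhyp, hwW, hwr, hw0,
        weilAnchorLocalClause_of_blochSpreadOfSubscheme_of_subschemeSeedAt d hB hS⟩
  ⟨weilTwelvefoldsSplit_of_reach_of_localAnchor_six hF hd hL, weilAlgebraicAll_le_five_of_reach_of_localAnchor_six hF hd hL⟩

/-- **Bloch door for a REDUCED lci UNION with smooth components at the S4 rung** (`BlochSemiregularSpreadSmoothComponents 12 6`, refereed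
named fact, + a union seed `HasBlochUnionSeedAt 6 P h_K w`: finitely many smooth components `Z_k ↪ P.X` of codimension `6`, the union
Bloch-semiregular, `q·h_K⁶ + w = μ·Σ[Z_k]`) ⟹ every split `√-d`-Weil twelvefold and `WeilAlgebraicAll 5 d ∧ 4 ∧ 3 ∧ 2` (p3's
`weilAnchorLocalClause_of_blochSpreadSmoothComponents_of_unionSeedAt` at `n = 6`). [cite: Bloch1972Semiregularity, Thm. (7.4) and Remark (7.5)]
[cite: Deligne1982HodgeCycles, proof of Thm. 4.8] [cite: Schoen1998HodgeWeilAddendum, 10 (Proposition), p. 332] -/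
theorem weilTwelvefoldsSplit_and_below_of_blochSpreadSmoothComponents_of_unionSeedAt_six
    (hB : BlochSemiregularSpreadSmoothComponents (2 * 6) 6) (hF : weilFamilyReach_hyperbolic) {d : ℕ} (hd : 0 < d)
    (P : AbelianVariety ℂ) (ψ₀ : P ⟶ P) (ι : ProjectiveEmbedding P.X) (a : complexBetti (projectiveSpace ι.n ℂ) 2)
    (w : complexBetti P.X (2 * 6)) (hP : P.dim = 2 * 6) (hψ : ψ₀ ≫ ψ₀ = -(d • 𝟙 P)) (ha : IsRationalClass a)
    (ha0 : a ≠ 0) (hhyp : IsHyperbolicWeilType P ψ₀ 6 (symmetrisedClass d P ψ₀ ι a))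
    (hwW : w ∈ weilClassesOf P ψ₀ 6 d) (hwr : IsRationalClass w) (hw0 : w ≠ 0)
    (hS : HasBlochUnionSeedAt 6 P (symmetrisedClass d P ψ₀ ι a) w) :
    Stubs.WeilAlgebraicSplitHyperplane 6 d ∧
      (WeilAlgebraicAll 5 d ∧ WeilAlgebraicAll 4 d ∧ WeilAlgebraicAll 3 d ∧ WeilAlgebraicAll 2 d) :=
  have hL : HasLocallyAlgebraicWeilAnchor 6 d :=
    (hasLocallyAlgebraicWeilAnchor_iff 6 d).2
      ⟨P, ψ₀, ι, a, w, hP, hψ, ha, ha0, hhyp, hwW, hwr, hw0,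
        weilAnchorLocalClause_of_blochSpreadSmoothComponents_of_unionSeedAt d hB hS⟩
  ⟨weilTwelvefoldsSplit_of_reach_of_localAnchor_six hF hd hL, weilAlgebraicAll_le_five_of_reach_of_localAnchor_six hF hd hL⟩

/-- **Twisted (`B`-field) door at the S4 rung — CLAIM-GRADE** (the door a `G`-equivariant / gerby design descends to, in its
`B`-field, LOCALLY FREE form; Perry 2026 Thm. 1.1 (2), arXiv preprint, UNREFEREED — tree claim-fact
`Perry2026_semiregularTwisted_remainsAlgebraic`, which bundles openness AND closedness along a smooth irreducible base): reach ∧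
Perry ∧ a hyperbolic `ℚ(√-d)`-anchor `(P, ψ, e, a)` of dimension `12` with a non-zero rational Weil class `w`, carrying on every chart
`F₀ ≅ P.X`, for every standard Chern character theory, a finite locally free FULLY semiregular `ℰ₀` (`IsISemiregular hE₀ Set.univ`)
and a rational `(1,1)` class `B₀` with `(exp(B₀) ∪ ch(ℰ₀))_k = q_k·h_Kᵏ` (`k ≠ 6`) and `= q₆·h_K⁶ + w` (`k = 6`) — Markman's
`κ`-class shape — ⟹ every split `√-d`-Weil twelvefold and `WeilAlgebraicAll 5 d ∧ 4 ∧ 3 ∧ 2` (instance `n = 6` of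
`WeilTypeLadder.hasLocallyAlgebraicWeilAnchor_of_perryTwisted_kappaAnchorObject`). Scope: `ℰ₀` locally free (Markman's `𝓑` is
REFLEXIVE twisted: not literally hosted); CLAIM-grade trust base. [claim: Perry2026Semiregularity, status: under-review]
[cite: Markman2025SecantWeil, §1.3 (v2 p. 6 L60–61, the class κ) and §1.5 (preprint)] [cite: Deligne1982HodgeCycles, proof of Thm. 4.8]
[cite: Schoen1998HodgeWeilAddendum, 10 (Proposition), p. 332] -/
theorem weilTwelvefoldsSplit_and_below_of_perryTwisted_kappaAnchorObject_six
    (hPe : Perry2026_semiregularTwisted_remainsAlgebraic) (hC : Nonempty StandardChernCharacterBetti)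
    (hF : weilFamilyReach_hyperbolic) {d : ℕ} (hd : 0 < d)
    (hO : ∃ (P : AbelianVariety ℂ) (ψ : P ⟶ P) (e : ProjectiveEmbedding P.X)
      (a : complexBetti (projectiveSpace e.n ℂ) 2) (w : complexBetti P.X (2 * 6)),
      P.dim = 2 * 6 ∧ ψ ≫ ψ = -(d • 𝟙 P) ∧ IsRationalClass a ∧ a ≠ 0 ∧
      IsHyperbolicWeilType P ψ 6
        ((d : ℂ) • complexBetti.map e.ι 2 a + complexBetti.map ψ.hom.hom.hom 2 (complexBetti.map e.ι 2 a)) ∧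
      w ∈ weilClassesOf P ψ 6 d ∧ IsRationalClass w ∧ w ≠ 0 ∧
      ∀ (F₀ : SchemeOver ℂ) (e₀ : P.X ≅ F₀) (C : StandardChernCharacterBetti),
        ∃ (E₀ : F₀.left.Modules) (hE₀ : IsFiniteLocallyFree E₀) (B₀ : complexBetti F₀ 2) (q : ℕ → ℚ),
          IsISemiregular hE₀ Set.univ ∧ IsRationalClass B₀ ∧ IsOfHodgeType (2 * 6) F₀ 2 1 1 B₀ ∧
          (∀ k : ℕ, k ≠ 6 →
            expTwistCh C.toChernCharacterBetti F₀ B₀ E₀ k = ((q k : ℚ) : ℂ) • complexBetti.map e₀.inv (2 * k)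
              (cupPowTwo ((d : ℂ) • complexBetti.map e.ι 2 a +
                complexBetti.map ψ.hom.hom.hom 2 (complexBetti.map e.ι 2 a)) k)) ∧
          expTwistCh C.toChernCharacterBetti F₀ B₀ E₀ 6 = complexBetti.map e₀.inv (2 * 6)
            (((q 6 : ℚ) : ℂ) • cupPowTwo ((d : ℂ) • complexBetti.map e.ι 2 a +
                complexBetti.map ψ.hom.hom.hom 2 (complexBetti.map e.ι 2 a)) 6 + w)) :
    Stubs.WeilAlgebraicSplitHyperplane 6 d ∧
      (WeilAlgebraicAll 5 d ∧ WeilAlgebraicAll 4 d ∧ WeilAlgebraicAll 3 d ∧ WeilAlgebraicAll 2 d) :=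
  have hL : HasLocallyAlgebraicWeilAnchor 6 d := hasLocallyAlgebraicWeilAnchor_of_perryTwisted_kappaAnchorObject 6 d hPe hC hO
  ⟨weilTwelvefoldsSplit_of_reach_of_localAnchor_six hF hd hL, weilAlgebraicAll_le_five_of_reach_of_localAnchor_six hF hd hL⟩

end Doors

/-! ## §4 BY VALUE: what a census row at the rung instantiates (perfect-complex / σ-door, unbundled binders) -/

section ByValue

open Literature.AlgebraicGeometry.KTheory

/-- **A hyperbolic seed of class `perfectObjClass C Adm` at level `N`, BY VALUE** (any `N`; the constructor a census row feeds):
a complex abelian `2N`-fold `P` with `ψ₀ ≫ ψ₀ = -(d • 𝟙 P)`, a projective embedding `e` and a rational `a ≠ 0` with `(P, ψ₀)` of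
hyperbolic Weil type for `h_K = symmetrisedClass d P ψ₀ e a`, a non-zero rational `w` in the Weil plane, degrees `I ∋ N`, ONE bounded
complex of vector bundles `E` on `P.X` admissible for `Adm`, and the CLASS IDENTITY `ch_N(E) = q·h_Kᴺ + w`, `ch_p(E) = c_p·h_Kᵖ` for
`p ∈ I`, `p ≠ N` ⟹ `HasHyperbolicSeedOn (perfectObjClass C Adm) N d` (unfolding of the two predicates; the g = 4 census row of
`AmplificationChainG4RouteC.weilFourfoldsSplit_of_reach_of_perfectComplexVariationalHodge_of_complex` inlines the same term).
[cite: Bloch1972Semiregularity, Remark (7.5) (the `a·z₀ + b·l₀ᵖ` shape)] [cite: vanGeemen1994HodgeAV, 5.2–5.4] -/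
theorem hasHyperbolicSeedOn_perfectObjClass_of_complex {C : ChernCharacterBetti} {Adm : AdmissibilityNotion} {N d : ℕ}
    (P : AbelianVariety ℂ) (ψ₀ : P ⟶ P) (e : ProjectiveEmbedding P.X) (a : complexBetti (projectiveSpace e.n ℂ) 2)
    (hP : P.dim = 2 * N) (hψ : ψ₀ ≫ ψ₀ = -(d • 𝟙 P)) (ha : IsRationalClass a) (ha0 : a ≠ 0)
    (hhyp : IsHyperbolicWeilType P ψ₀ N (symmetrisedClass d P ψ₀ e a))
    (w : complexBetti P.X (2 * N)) (hwW : w ∈ weilClassesOf P ψ₀ N d) (hwr : IsRationalClass w) (hw0 : w ≠ 0)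
    (I : Finset ℕ) (hN : N ∈ I) (E : CochainComplex P.X.left.Modules ℤ) (hE : IsBoundedVBComplex E)
    (hAdm : Adm (2 * N) P.X I E) (q : ℚ) (c : ℕ → ℚ)
    (hchN : chPerfect C P.X E hE.isFiniteLocallyFree N = ((q : ℚ) : ℂ) • cupPowTwo (symmetrisedClass d P ψ₀ e a) N + w)
    (hchp : ∀ p ∈ I, p ≠ N →
      chPerfect C P.X E hE.isFiniteLocallyFree p = ((c p : ℚ) : ℂ) • cupPowTwo (symmetrisedClass d P ψ₀ e a) p) :
    HasHyperbolicSeedOn (perfectObjClass C Adm) N d :=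
  ⟨P, ψ₀, e, a, w, hP, hψ, ha, ha0, hhyp, hwW, hwr, hw0, I, fun p ↦ chPerfect C P.X E hE.isFiniteLocallyFree p, q, c, hN,
    ⟨E, hE, hAdm, fun _ _ ↦ rfl⟩, hchN, hchp⟩

/-- **The S4 rung BY VALUE, σ-door** — the declaration a certified n = 6 census row instantiates. BINDERS, all real tree carriers:
the split CM anchor `(P, ψ₀, e, a)` of dimension `12`; a non-zero rational `w` in its Weil plane; `I ⊇ {1, …, 12}`; ONE bounded complex of
vector bundles `E` on `P.X` in degrees `[a', b']` with `Ext^{<0}(E,E) = 0`, `Hom(E,E) = ℂ` (`extRank`) and `(σ_q(E))_{q+1 ∈ I}` JOINTLY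
INJECTIVE (`HomComplex.IsISemiregularC`, BY VALUE: the row's «σ-rank = dim Ext² on two codes» certificate; no kernel computation discharges
it); the class identity `ch₆(E) = q·h_K⁶ + w`, `ch_p(E) = c_p·h_Kᵖ` off `6` (the row's CLASS ×2 certificate). HYPOTHESES BY NAME:
`weilFamilyReach_hyperbolic` (refereed) and `PerfectComplexDeformsOverEtaleNbhd C sigmaAdmissible` (printed object hypothesis + printed étale
conclusion shape; implied in the tree by `PridhamPerfectLifts C` ∧ Lieblich-type versal charts). CONCLUSION: every split `√-d`-Weil twelvefold
and `WeilAlgebraicAll 5 d ∧ 4 ∧ 3 ∧ 2`. A `G`-equivariant / twisted design is NOT an instance (twisted door). Nothing is claimed to exist.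
[cite: Perry2022, proof of Prop. 8.1] [cite: Pridham2024Semiregularity, Cor. 2.25, Rem. 2.27] [cite: BuchweitzFlenner2003, Def. 4.1 and §5 (I-semiregular)]
[cite: Deligne1982HodgeCycles, proof of Thm. 4.8] [cite: Schoen1998HodgeWeilAddendum, 10 (Proposition), p. 332] -/
theorem weilTwelvefoldsSplit_and_below_of_deformsOverEtaleNbhd_sigma_of_complex_six {C : ChernCharacterBetti}
    (hF : weilFamilyReach_hyperbolic) (hD : PerfectComplexDeformsOverEtaleNbhd C sigmaAdmissible) {d : ℕ} (hd : 0 < d)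
    (P : AbelianVariety ℂ) (ψ₀ : P ⟶ P) (e : ProjectiveEmbedding P.X) (a : complexBetti (projectiveSpace e.n ℂ) 2)
    (hP : P.dim = 2 * 6) (hψ : ψ₀ ≫ ψ₀ = -(d • 𝟙 P)) (ha : IsRationalClass a) (ha0 : a ≠ 0)
    (hhyp : IsHyperbolicWeilType P ψ₀ 6 (symmetrisedClass d P ψ₀ e a))
    (w : complexBetti P.X (2 * 6)) (hwW : w ∈ weilClassesOf P ψ₀ 6 d) (hwr : IsRationalClass w) (hw0 : w ≠ 0)
    (I : Finset ℕ) (hI : ∀ p : ℕ, 1 ≤ p → p ≤ 2 * 6 → p ∈ I) (E : CochainComplex P.X.left.Modules ℤ)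
    (hE : IsBoundedVBComplex E) (hneg : ∀ k : ℤ, k < 0 → extRank P.X E k = 0) (h0 : extRank P.X E 0 = 1)
    (a' b' : ℤ) [E.IsStrictlyGE a'] [E.IsStrictlyLE b']
    (hσ : letI := HasDerivedCategory.standard P.X.left.Modules
      HomComplex.IsISemiregularC P.X E a' b' hE.isFiniteLocallyFree {q | q + 1 ∈ I})
    (q : ℚ) (c : ℕ → ℚ)
    (hch6 : chPerfect C P.X E hE.isFiniteLocallyFree 6 = ((q : ℚ) : ℂ) • cupPowTwo (symmetrisedClass d P ψ₀ e a) 6 + w)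
    (hchp : ∀ p ∈ I, p ≠ 6 →
      chPerfect C P.X E hE.isFiniteLocallyFree p = ((c p : ℚ) : ℂ) • cupPowTwo (symmetrisedClass d P ψ₀ e a) p) :
    Stubs.WeilAlgebraicSplitHyperplane 6 d ∧
      (WeilAlgebraicAll 5 d ∧ WeilAlgebraicAll 4 d ∧ WeilAlgebraicAll 3 d ∧ WeilAlgebraicAll 2 d) :=
  weilTwelvefoldsSplit_and_below_of_deformsOverEtaleNbhd_of_hyperbolicSeedOn_six hD hF hd
    (hasHyperbolicSeedOn_perfectObjClass_of_complex P ψ₀ e a hP hψ ha ha0 hhyp w hwW hwr hw0 I (hI 6 (by norm_num) (by norm_num))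
      E hE ⟨hI, hneg, h0, a', b', inferInstance, inferInstance, hE.isFiniteLocallyFree, hσ⟩ q c hch6 hchp)

/-- **The S4 rung BY VALUE, Buchweitz–Flenner sheaf door** (a VECTOR-BUNDLE box at the rung would instantiate this): the split CM
anchor `(P, ψ₀, e, a)` of dimension `12`, a non-zero rational `w` in its Weil plane, `I ∋ 6`, ONE finite locally free `ℰ₀` ON `P.X`
whose semiregularity components `(σ_q)_{q+1 ∈ I}` are JOINTLY INJECTIVE (`IsISemiregular`, the tree's real `σ_q = Tr(∗ ∘ At^q/q!)`; BY
VALUE — the row's σ ×2 certificate), and the class identity `ch₆(ℰ₀) = q·h_K⁶ + w`, `ch_p(ℰ₀) = c_p·h_Kᵖ` off `6` (CLASS ×2) ⟹ under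
`weilFamilyReach_hyperbolic` and BF Thm. 5.1 (model rendering, refereed named fact) every split `√-d`-Weil twelvefold and
`WeilAlgebraicAll 5 d ∧ 4 ∧ 3 ∧ 2`. Scope: `ℰ₀` finite locally free, untwisted; a `G`-equivariant / twisted design is NOT an instance.
[cite: BuchweitzFlenner2003, §5 Thm. 5.1 and Def. 4.1] [cite: Deligne1982HodgeCycles, proof of Thm. 4.8] [cite: Schoen1998HodgeWeilAddendum, 10 (Proposition), p. 332] -/
theorem weilTwelvefoldsSplit_and_below_of_BFmodel_of_sheaf_six {C : ChernCharacterBetti}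
    (hBF : BuchweitzFlenner2003_variationalHodge_ISemiregular_model) (hF : weilFamilyReach_hyperbolic) {d : ℕ} (hd : 0 < d)
    (P : AbelianVariety ℂ) (ψ₀ : P ⟶ P) (e : ProjectiveEmbedding P.X) (a : complexBetti (projectiveSpace e.n ℂ) 2)
    (hP : P.dim = 2 * 6) (hψ : ψ₀ ≫ ψ₀ = -(d • 𝟙 P)) (ha : IsRationalClass a) (ha0 : a ≠ 0)
    (hhyp : IsHyperbolicWeilType P ψ₀ 6 (symmetrisedClass d P ψ₀ e a))
    (w : complexBetti P.X (2 * 6)) (hwW : w ∈ weilClassesOf P ψ₀ 6 d) (hwr : IsRationalClass w) (hw0 : w ≠ 0)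
    (I : Finset ℕ) (h6 : 6 ∈ I) (E₀ : P.X.left.Modules) (hE₀ : IsFiniteLocallyFree E₀)
    (hsr : IsISemiregular hE₀ {q' | q' + 1 ∈ I}) (q : ℚ) (c : ℕ → ℚ)
    (hch6 : C.ch P.X E₀ 6 = ((q : ℚ) : ℂ) • cupPowTwo (symmetrisedClass d P ψ₀ e a) 6 + w)
    (hchp : ∀ p ∈ I, p ≠ 6 → C.ch P.X E₀ p = ((c p : ℚ) : ℂ) • cupPowTwo (symmetrisedClass d P ψ₀ e a) p) :
    Stubs.WeilAlgebraicSplitHyperplane 6 d ∧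
      (WeilAlgebraicAll 5 d ∧ WeilAlgebraicAll 4 d ∧ WeilAlgebraicAll 3 d ∧ WeilAlgebraicAll 2 d) :=
  weilTwelvefoldsSplit_and_below_of_BFmodel_of_hyperbolicBFSheafSeedOn_six hBF hF hd
    ⟨P, ψ₀, e, a, w, hP, hψ, ha, ha0, hhyp, hwW, hwr, hw0, E₀, hE₀, q, c, h6, hsr, hch6, hchp⟩

end ByValue

/-! ## Audit: nothing is decided here
Every theorem carries a SEED / ANCHOR hypothesis at level `6` (`HasLocallyAlgebraicWeilAnchor 6 d`, `HasHyperbolicSeedOn 𝒪 6 d`,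
`HasHyperbolicBlochSeed 6 d`, `HasHyperbolicBFSheafSeedOn C 6 d I`, `HasHyperbolicBFSheafSeed C 6 d I`, or the by-value / `κ`-object
binders) — the S4 object the search lane looks for, NOT claimed — AND the openness statement of its door BY NAME (refereed facts,
the venture assumption `PerfectComplexDeformsOverEtaleNbhd`, or the CLAIM-fact `Perry2026_semiregularTwisted_remainsAlgebraic`),
plus `weilFamilyReach_hyperbolic` BY NAME. No `def`; no named fact minted. -/

end Summit.Ventures.HSemireg
end
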